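import Literature.MathematicalPhysics.PowerSystems.CutsetStabilityCriterion
import HarnessLib

/-!
# Delabays–Coletta–Jacquod's Theorem 4.1: on the homogeneous unloaded ring every stable synchronous
# state has ALL angle differences in `[−π/2, π/2]` — every synchronous state with a line of negative
# cosine admits a negative direction of the Hesse form, and is an UNSTABLE synchronous solution
# whenever its Hesse matrix is transversally nondegenerate (automatic for an ODD number of machines)

Topic `Literature/MathematicalPhysics/PowerSystems`, namespace
`Literature.MathematicalPhysics.PowerSystems.ClassicalModel`. Closes the ring story of this topic:
`RingMultistability` / `RingNormalOperationCensus` (gridfusion-lit-1: the normal-operation synchronous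
states of `ringSystem n K M D` are exactly the `2⌈N/4⌉ − 1` twisted states with `4|q| < N`, all
STABLE), `RingTwistedStateInstability` (twisted states with `4|q| > N` UNSTABLE),
`CutsetStabilityCriterion` (two negative-cosine lines ⇒ unstable). Here: ANY synchronous state of the
unloaded ring with at least ONE line of negative cosine (and none at cosine zero) has a negative
Hesse direction — so, modulo degeneracy, «stable ⇔ normal operation ⇔ twisted with 4|q| < N».
Everything below is PROVED (no definition, no named fact, no new axiom).

SOURCE (read on the page this session). R. Delabays, T. Coletta, P. Jacquod, J. Math. Phys. 57
(2016) 032701 [DelabaysColettaJacquod2016] (`lit read arxiv:1512.04266`, chunks p0009 L101–L120,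
p0010 L1–L58). **Theorem 4.1.** «For K → ∞, any stable solution of the power flow Eq. on a cycle
network has all angle differences in [−π/2, π/2]. Furthermore all angle differences are equal to
2πq/n, where q is the winding number of the solution.» PROOF (p0010): «when K → ∞, the sine of the
angle difference along every line of the cycle tends to the same value ε. This implies that the angle
difference along each line belongs to {arcsin(ε), π − arcsin(ε)} and thus the cosine of the angle
differences along all the lines takes the same absolute value with either positive or negative sign …
if all angle differences are π − arcsin(ε), then all cosines are negative and the stability matrix is
obviously positive semi-definite [i.e. −M is negative semidefinite]. The solution is then unstable. Let
us now consider the mixed case … there exists at least one node i such that Δ_{i−1,i} = arcsin(ε) and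
Δ_{i,i+1} = π − arcsin(ε) and the corresponding stability matrix has the form M′ = Kc(… x 1 0 / 1 0 −1 /
0 −1 y …). The principal minor of −M′ with row and column indices {i, i+1} is −1, which, by
Sylvester's criterion, implies that M′ is not negative semi-definite … the solution is unstable.»
(«K → ∞» at fixed injections = injections negligible against the coupling = the UNLOADED homogeneous
ring `P ≡ 0` of this topic, where «sin Δ the same on every line» holds exactly:
`ring_sin_edge_eq_of_flow_eq_zero`.)

## What is proved (`S` a ring with capacities `Kₖ > 0`, hypothesis `hC`; `ρ = finRotate (n+1)`;
`cosₖ = cos(θₖ − θ_{ρk})` the cosine of the line `(k, ρk)`)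

* §1 (loaded rings) `loadedRing_hessForm_single` (`Q(eₖ) = Kₖcosₖ + K_{ρ⁻¹k}cos_{ρ⁻¹k}`),
  `loadedRing_hessForm_pair` (`Q(−e_{ρk} + e_{ρ²k}) = Kₖcosₖ + 4K_{ρk}cos_{ρk} + K_{ρ²k}cos_{ρ²k}` — the
  source's `{i, i+1}` principal-minor test as an explicit vector), `exists_short_long_adjacent` (a short
  and a long line somewhere ⇒ a node where a short line is followed by a long one).
* §2 (loaded rings) **`loadedRing_hessMatrix_ker_const`**: if no line has `Kₖcosₖ = 0` and
  `Σₖ (Kₖcosₖ)⁻¹ ≠ 0` then the Hesse matrix is nondegenerate transversally to the rotation (kernel =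
  constants) — Kirchhoff for the linearisation: `M v = 0` forces one constant «flow» `Kₖcosₖ(vₖ − v_{ρk})`
  around the cycle, which must vanish.
* §3 (unloaded homogeneous ring `ringSystem n K M D`, `N = n + 1 ≥ 3`, `K > 0`)
  `ringSystem_abs_cos_eq` («the cosine … takes the same absolute value»), ★
  **`ringSystem_exists_negativeDirection_of_long_line`** (a synchronous state with a line of negative
  cosine and none of zero cosine has `Q(θ; v) < 0` for an explicit `v`),
  `ringSystem_not_isLocalMin_of_long_line` (hence it is NOT a local minimum of the energy),
  ★★ **`ringSystem_unstable_syncSolution_of_long_line`** (if moreover the Hesse matrix is transversally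
  nondegenerate, the synchronous solution is UNSTABLE), `ringSystem_sum_inv_cos_ne_zero_of_odd` and
  ★★★ **`ringSystem_unstable_syncSolution_of_long_line_of_odd`** — for an ODD number of machines the
  nondegeneracy is automatic (`#short − #long` is odd, hence `Σ 1/cosₖ ≠ 0`): EVERY synchronous state of
  the unloaded homogeneous ring `R_N`, `N` odd, with a line of negative cosine and none of zero cosine
  is an UNSTABLE synchronous solution of the damped swing model. With `ring_normalOperation_census`
  this is Thm 4.1's dichotomy for the motions: stable ⇔ all cosines positive ⇔ twisted with `4|q| < N`.

DEVIATIONS. (i) «K → ∞» is typed as `P ≡ 0` (the limit statement itself is not typed); (ii) the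
source's Sylvester-minor step is replaced by the explicit test vector `−e_{ρk} + e_{ρ²k}` (same
content); (iii) the dynamic conclusion needs transversal nondegeneracy (§G46) — discharged here for
odd `N`; for even `N` the balanced states (`#short = #long`, a continuum of equilibria) are left
undecided, and lines at `cos = 0` are excluded throughout, as the print's strictness suggests.

THREE COLUMNS. CERTIFIED for MODEL `M` = damped lossless swing model on the homogeneous unloaded
ring (MV-1 class): the instability of every synchronous state outside normal operation (odd `N`: no
further hypothesis; even `N`: given nondegeneracy). NOT CLAIMED: degenerate states, loaded rings
beyond §1–§2, anything about a power system.
-/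

noncomputable section

open Real Set Filter Topology Metric Finset
open scoped Matrix

namespace Literature.MathematicalPhysics.PowerSystems

namespace ClassicalModel

section LoadedRing

variable {n : ℕ} (S : LosslessSystem (n + 1) 0) (Kv : Fin (n + 1) → ℝ)

/-! ### §0. Ring plumbing -/

/-- `ρ(ρ k) ≠ k` on a ring of at least three machines. [folklore] -/
private theorem rotate_rotate_ne (hn : 2 ≤ n) (k : Fin (n + 1)) :
    finRotate (n + 1) (finRotate (n + 1) k) ≠ k := by
  intro h
  have hv1 : (finRotate (n + 1) k).val = if k = Fin.last n then 0 else k.val + 1 := coe_finRotate k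
  have hv2 : (finRotate (n + 1) (finRotate (n + 1) k)).val
      = if finRotate (n + 1) k = Fin.last n then 0 else (finRotate (n + 1) k).val + 1 :=
    coe_finRotate _
  rw [h] at hv2
  have hklt : k.val < n + 1 := k.isLt
  by_cases hl : k = Fin.last n
  · have hkn : k.val = n := by rw [hl, Fin.val_last]
    rw [if_pos hl] at hv1
    have hne : finRotate (n + 1) k ≠ Fin.last n := by
      intro h'
      have h'' := congrArg Fin.val h'
      rw [hv1, Fin.val_last] at h''
      omega
    rw [if_neg hne, hv1] at hv2
    omega
  · rw [if_neg hl] at hv1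
    have hkn : k.val ≠ n := fun h' => hl (Fin.ext (by rw [h', Fin.val_last]))
    by_cases hl2 : finRotate (n + 1) k = Fin.last n
    · have h'' := congrArg Fin.val hl2
      rw [hv1, Fin.val_last] at h''
      rw [if_pos hl2] at hv2
      omega
    · rw [if_neg hl2, hv1] at hv2
      omega

/-- `ρ k ≠ k` on a ring of at least two machines. [folklore] -/
private theorem rotate_ne (hn : 1 ≤ n) (k : Fin (n + 1)) : finRotate (n + 1) k ≠ k := by
  intro h
  have hv : (finRotate (n + 1) k).val = if k = Fin.last n then 0 else k.val + 1 := coe_finRotate k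
  rw [h] at hv
  by_cases hl : k = Fin.last n
  · rw [if_pos hl] at hv
    have : k.val = n := by rw [hl, Fin.val_last]
    omega
  · rw [if_neg hl] at hv
    omega

/-- Walking along the cycle from any node reaches every node: a property that holds at `k₀` and
propagates along `ρ` holds everywhere. [folklore] -/
private theorem ring_walk_from {P : Fin (n + 1) → Prop} (h : ∀ k, P k → P (finRotate (n + 1) k))
    (k₀ : Fin (n + 1)) (hk₀ : P k₀) : ∀ j, P j := by
  have hiter : ∀ i : ℕ, P ((finRotate (n + 1))^[i] k₀) := by
    intro i
    induction i with
    | zero => simpa using hk₀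
    | succ i ih => rw [Function.iterate_succ_apply']; exact h _ ih
  intro j
  have e : (finRotate (n + 1))^[(j - k₀).val] k₀ = j := by
    rw [← finCycle_eq_finRotate_iterate, finCycle_apply, add_sub_cancel]
  have h1 := hiter (j - k₀).val
  rwa [e] at h1

/-- A quantity invariant under the cyclic shift is constant on the ring. [folklore] -/
private theorem ring_walk_eq' {α : Type*} {g : Fin (n + 1) → α}
    (h : ∀ k, g (finRotate (n + 1) k) = g k) : ∀ j, g j = g 0 := by
  intro j
  exact (ring_walk_from (P := fun k => g k = g 0) (fun k hk => by rw [h k]; exact hk) 0 rfl j)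

/-! ### §1. Two explicit test vectors and the short/long adjacency (loaded rings) -/

/-- **The Hesse form on a single node**: `Q(eₖ) = Kₖcos(θₖ − θ_{ρk}) + K_{ρ⁻¹k}cos(θ_{ρ⁻¹k} − θₖ)` —
negative when both lines at `k` have negative cosine («if all cosines are negative … unstable»).
[cite: DelabaysColettaJacquod2016, §4.2 proof of Thm 4.1 (the all-negative case)] -/
theorem loadedRing_hessForm_single (hn : 2 ≤ n)
    (hC : ∀ i j, S.C i j = if j = finRotate (n + 1) i then Kv i
      else if i = finRotate (n + 1) j then Kv j else 0)
    (θ : Fin (n + 1) → ℝ) (k : Fin (n + 1)) :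
    1 / 2 * ∑ i, ∑ j, S.C i j * Real.cos (θ i - θ j)
        * ((if i = k then (1 : ℝ) else 0) - (if j = k then (1 : ℝ) else 0)) ^ 2
      = Kv k * Real.cos (θ k - θ (finRotate (n + 1) k))
        + Kv ((finRotate (n + 1)).symm k)
          * Real.cos (θ ((finRotate (n + 1)).symm k) - θ k) := by
  rw [loadedRing_hessForm_eq_edges S Kv hn hC θ (fun i => if i = k then (1 : ℝ) else 0)]
  have hρk : finRotate (n + 1) k ≠ k := rotate_ne (by omega) k
  -- the squared jump is `1` exactly on the lines `k` and `ρ⁻¹k`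
  have hpt : ∀ a : Fin (n + 1),
      ((if a = k then (1 : ℝ) else 0) - (if finRotate (n + 1) a = k then (1 : ℝ) else 0)) ^ 2
      = (if a = k then (1 : ℝ) else 0) + (if a = (finRotate (n + 1)).symm k then (1 : ℝ) else 0) := by
    intro a
    have hiff : finRotate (n + 1) a = k ↔ a = (finRotate (n + 1)).symm k := by
      rw [Equiv.eq_symm_apply]
    by_cases h1 : a = k
    · have h2 : finRotate (n + 1) a ≠ k := by rw [h1]; exact hρk
      have h3 : a ≠ (finRotate (n + 1)).symm k := fun h => h2 (hiff.2 h)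
      rw [if_pos h1, if_neg h2, if_neg h3]
      norm_num
    · by_cases h2 : finRotate (n + 1) a = k
      · rw [if_neg h1, if_pos h2, if_pos (hiff.1 h2)]
        norm_num
      · rw [if_neg h1, if_neg h2, if_neg (fun h => h2 (hiff.2 h))]
        norm_num
  simp only [hpt, mul_add, Finset.sum_add_distrib, mul_ite, mul_one, mul_zero, Finset.sum_ite_eq',
    Finset.mem_univ, if_true, Equiv.apply_symm_apply]

/-- **The Hesse form on the source's `{i, i+1}` test pair**: for the vector `−e_{ρk} + e_{ρ²k}`,
`Q = Kₖcosₖ + 4K_{ρk}cos_{ρk} + K_{ρ²k}cos_{ρ²k}` (lines `k`, `ρk`, `ρ²k` with squared jumps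
`1, 4, 1`; ring of at least three machines). [cite: DelabaysColettaJacquod2016, §4.2 proof of Thm 4.1 (the mixed case: «the principal minor of −M′ with row and column indices {i, i+1} is −1»)] -/
theorem loadedRing_hessForm_pair (hn : 2 ≤ n)
    (hC : ∀ i j, S.C i j = if j = finRotate (n + 1) i then Kv i
      else if i = finRotate (n + 1) j then Kv j else 0)
    (θ : Fin (n + 1) → ℝ) (k : Fin (n + 1)) :
    1 / 2 * ∑ i, ∑ j, S.C i j * Real.cos (θ i - θ j)
        * (((if i = finRotate (n + 1) (finRotate (n + 1) k) then (1 : ℝ) else 0)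
            - (if i = finRotate (n + 1) k then (1 : ℝ) else 0))
          - ((if j = finRotate (n + 1) (finRotate (n + 1) k) then (1 : ℝ) else 0)
            - (if j = finRotate (n + 1) k then (1 : ℝ) else 0))) ^ 2
      = Kv k * Real.cos (θ k - θ (finRotate (n + 1) k))
        + 4 * (Kv (finRotate (n + 1) k)
          * Real.cos (θ (finRotate (n + 1) k) - θ (finRotate (n + 1) (finRotate (n + 1) k))))
        + Kv (finRotate (n + 1) (finRotate (n + 1) k))
          * Real.cos (θ (finRotate (n + 1) (finRotate (n + 1) k))
            - θ (finRotate (n + 1) (finRotate (n + 1) (finRotate (n + 1) k)))) := by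
  rw [loadedRing_hessForm_eq_edges S Kv hn hC θ (fun i =>
    (if i = finRotate (n + 1) (finRotate (n + 1) k) then (1 : ℝ) else 0)
      - (if i = finRotate (n + 1) k then (1 : ℝ) else 0))]
  have hinj : Function.Injective (finRotate (n + 1)) := (finRotate (n + 1)).injective
  -- distinctness on a ring of ≥ 3 machines
  have h10 : finRotate (n + 1) k ≠ k := rotate_ne (by omega) k
  have h20 : finRotate (n + 1) (finRotate (n + 1) k) ≠ k := rotate_rotate_ne hn k
  have h21 : finRotate (n + 1) (finRotate (n + 1) k) ≠ finRotate (n + 1) k := rotate_ne (by omega) _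
  have h31 : finRotate (n + 1) (finRotate (n + 1) (finRotate (n + 1) k)) ≠ finRotate (n + 1) k :=
    rotate_rotate_ne hn _
  have h32 : finRotate (n + 1) (finRotate (n + 1) (finRotate (n + 1) k))
      ≠ finRotate (n + 1) (finRotate (n + 1) k) := rotate_ne (by omega) _
  -- the squared jumps: `1` on line `k`, `4` on line `ρk`, `1` on line `ρ²k`, `0` elsewhere
  have hpt : ∀ a : Fin (n + 1),
      (((if a = finRotate (n + 1) (finRotate (n + 1) k) then (1 : ℝ) else 0)
          - (if a = finRotate (n + 1) k then (1 : ℝ) else 0))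
        - ((if finRotate (n + 1) a = finRotate (n + 1) (finRotate (n + 1) k) then (1 : ℝ) else 0)
          - (if finRotate (n + 1) a = finRotate (n + 1) k then (1 : ℝ) else 0))) ^ 2
      = (if a = k then (1 : ℝ) else 0) + (if a = finRotate (n + 1) k then (4 : ℝ) else 0)
        + (if a = finRotate (n + 1) (finRotate (n + 1) k) then (1 : ℝ) else 0) := by
    intro a
    have e1 : (finRotate (n + 1) a = finRotate (n + 1) (finRotate (n + 1) k))
        ↔ a = finRotate (n + 1) k := hinj.eq_iff
    have e2 : (finRotate (n + 1) a = finRotate (n + 1) k) ↔ a = k := hinj.eq_iff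
    simp only [e1, e2]
    by_cases ha0 : a = k
    · subst ha0
      simp only [Ne.symm h10, Ne.symm h20, if_true, if_false]
      norm_num
    · by_cases ha1 : a = finRotate (n + 1) k
      · subst ha1
        simp only [h10, Ne.symm h21, if_true, if_false]
        norm_num
      · by_cases ha2 : a = finRotate (n + 1) (finRotate (n + 1) k)
        · subst ha2
          simp only [h20, h21, if_true, if_false]
          norm_num
        · simp only [ha0, ha1, ha2, if_false]
          norm_num
  simp only [hpt, mul_add, Finset.sum_add_distrib, mul_ite, mul_zero, Finset.sum_ite_eq',
    Finset.mem_univ, if_true]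
  ring

/-- **Where a short line meets a long one**: if some line has positive cosine, some line negative
cosine, and none zero cosine, then at some node a line of positive cosine is FOLLOWED by one of
negative cosine («there exists at least one node i such that Δ_{i−1,i} = arcsin(ε) and
Δ_{i,i+1} = π − arcsin(ε)»). [cite: DelabaysColettaJacquod2016, §4.2 proof of Thm 4.1 (mixed case)] -/
theorem exists_short_long_adjacent {θ : Fin (n + 1) → ℝ}
    (h0 : ∀ k, Real.cos (θ k - θ (finRotate (n + 1) k)) ≠ 0)
    (hpos : ∃ k, 0 < Real.cos (θ k - θ (finRotate (n + 1) k)))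
    (hneg : ∃ k, Real.cos (θ k - θ (finRotate (n + 1) k)) < 0) :
    ∃ k, 0 < Real.cos (θ k - θ (finRotate (n + 1) k)) ∧
      Real.cos (θ (finRotate (n + 1) k) - θ (finRotate (n + 1) (finRotate (n + 1) k))) < 0 := by
  by_contra hcon
  push Not at hcon
  obtain ⟨k₀, hk₀⟩ := hpos
  obtain ⟨k₁, hk₁⟩ := hneg
  have hall : ∀ j, 0 < Real.cos (θ j - θ (finRotate (n + 1) j)) :=
    ring_walk_from (P := fun k => 0 < Real.cos (θ k - θ (finRotate (n + 1) k)))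
      (fun k hk => lt_of_le_of_ne (hcon k hk) (h0 _).symm) k₀ hk₀
  exact absurd (hall k₁) (not_lt.2 hk₁.le)

/-! ### §2. Kirchhoff for the linearisation: transversal nondegeneracy of the ring's Hesse matrix -/

/-- **On a ring the Hesse matrix is nondegenerate transversally to the rotation as soon as no line
has zero weight `Kₖcosₖ` and `Σₖ (Kₖcosₖ)⁻¹ ≠ 0`**: `M(θ)v = 0` makes the linearised line flows
`Kₖcosₖ(vₖ − v_{ρk})` equal around the cycle (node balance), their common value `Φ` satisfies
`Φ·Σₖ(Kₖcosₖ)⁻¹ = Σₖ(vₖ − v_{ρk}) = 0`, so `Φ = 0` and `v` is constant. (For a signed cycle this is the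
exact degeneracy criterion; the source decides definiteness by principal minors instead.)
[cite: DelabaysColettaJacquod2016, §4.2 proof of Thm 4.1 (stability matrix of the cycle); ManikTimmeWitthaut2017, §3 Lemma 1 («M has one eigenvector (1,…,1) with eigenvalue 0»)] -/
theorem loadedRing_hessMatrix_ker_const (hn : 2 ≤ n)
    (hC : ∀ i j, S.C i j = if j = finRotate (n + 1) i then Kv i
      else if i = finRotate (n + 1) j then Kv j else 0)
    {θ : Fin (n + 1) → ℝ}
    (hw : ∀ k, Kv k * Real.cos (θ k - θ (finRotate (n + 1) k)) ≠ 0)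
    (hsum : ∑ k, (Kv k * Real.cos (θ k - θ (finRotate (n + 1) k)))⁻¹ ≠ 0) :
    ∀ v : Fin (n + 1) → ℝ, S.hessMatrix θ *ᵥ v = 0 → ∃ a : ℝ, v = fun _ => a := by
  intro v hv
  -- node balance: `(M v)_k = φ k − φ (ρ⁻¹ k) = 0` for the linearised line flows
  -- `φ a = K_a cos_a (v_a − v_{ρa})`
  have hbal : ∀ k, Kv k * Real.cos (θ k - θ (finRotate (n + 1) k)) * (v k - v (finRotate (n + 1) k))
      - Kv ((finRotate (n + 1)).symm k)
        * Real.cos (θ ((finRotate (n + 1)).symm k) - θ (finRotate (n + 1) ((finRotate (n + 1)).symm k)))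
        * (v ((finRotate (n + 1)).symm k) - v (finRotate (n + 1) ((finRotate (n + 1)).symm k))) = 0 := by
    intro k
    have h1 := congrFun hv k
    rw [Pi.zero_apply, S.hessMatrix_mulVec θ v k] at h1
    simp only [Finset.univ_eq_empty, Finset.sum_empty, zero_mul, add_zero] at h1
    have h2 := loadedRing_row_sum S Kv hn hC (fun j => Real.cos (θ k - θ j) * (v k - v j)) k
    have h3 : ∑ j, S.C k j * Real.cos (θ k - θ j) * (v k - v j)
        = ∑ j, S.C k j * (Real.cos (θ k - θ j) * (v k - v j)) :=
      Finset.sum_congr rfl fun j _ => by ring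
    rw [h3, h2] at h1
    have h4 : Real.cos (θ k - θ ((finRotate (n + 1)).symm k))
        = Real.cos (θ ((finRotate (n + 1)).symm k)
          - θ (finRotate (n + 1) ((finRotate (n + 1)).symm k))) := by
      rw [Equiv.apply_symm_apply, ← Real.cos_neg, neg_sub]
    have h5 : v k - v ((finRotate (n + 1)).symm k)
        = -(v ((finRotate (n + 1)).symm k) - v (finRotate (n + 1) ((finRotate (n + 1)).symm k))) := by
      rw [Equiv.apply_symm_apply]; ring
    rw [h4, h5] at h1
    linarith
  -- hence `φ` is constant around the cycle
  have hstep : ∀ j, Kv (finRotate (n + 1) j)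
      * Real.cos (θ (finRotate (n + 1) j) - θ (finRotate (n + 1) (finRotate (n + 1) j)))
      * (v (finRotate (n + 1) j) - v (finRotate (n + 1) (finRotate (n + 1) j)))
      = Kv j * Real.cos (θ j - θ (finRotate (n + 1) j)) * (v j - v (finRotate (n + 1) j)) := by
    intro j
    have h := hbal (finRotate (n + 1) j)
    rw [Equiv.symm_apply_apply] at h
    linarith
  have hconst : ∀ j, Kv j * Real.cos (θ j - θ (finRotate (n + 1) j)) * (v j - v (finRotate (n + 1) j))
      = Kv 0 * Real.cos (θ 0 - θ (finRotate (n + 1) 0)) * (v 0 - v (finRotate (n + 1) 0)) :=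
    ring_walk_eq' (g := fun a => Kv a * Real.cos (θ a - θ (finRotate (n + 1) a))
      * (v a - v (finRotate (n + 1) a))) hstep
  -- the jumps sum to zero around the cycle, so `Φ · Σ 1/(K cos) = 0` and `Φ = 0`
  set Φ := Kv 0 * Real.cos (θ 0 - θ (finRotate (n + 1) 0)) * (v 0 - v (finRotate (n + 1) 0)) with hΦdef
  have hjump : ∀ k, v k - v (finRotate (n + 1) k)
      = Φ * (Kv k * Real.cos (θ k - θ (finRotate (n + 1) k)))⁻¹ := by
    intro k
    have h := hconst k
    rw [← div_eq_mul_inv, eq_div_iff (hw k), ← h]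
    ring
  have hsum0 : ∑ k, (v k - v (finRotate (n + 1) k)) = 0 := by
    rw [Finset.sum_sub_distrib, Equiv.sum_comp (finRotate (n + 1)) v, sub_self]
  rw [Finset.sum_congr rfl fun k _ => hjump k, ← Finset.mul_sum] at hsum0
  have hΦ : Φ = 0 := by
    rcases mul_eq_zero.1 hsum0 with h | h
    · exact h
    · exact absurd h hsum
  -- so `v` is invariant under the shift, hence constant
  have hv' : ∀ k, v (finRotate (n + 1) k) = v k := by
    intro k
    have h := hjump k
    rw [hΦ, zero_mul] at h
    linarith
  exact ⟨v 0, funext fun j => ring_walk_eq' hv' j⟩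

end LoadedRing

/-! ### §3. The homogeneous unloaded ring: Theorem 4.1 -/

section Ring

variable {n : ℕ} (K : ℝ) (M D : Fin (n + 1) → ℝ)

/-- The coupling of `ringSystem` in the `if … else if …` form of the loaded-ring files (constant
capacity `K`). [cite: ManikTimmeWitthaut2017, §5.4 Cor. 4 («homogeneous rings R_N, i.e. K_{i,i+1} = K»)] -/
theorem ringSystem_C_if (i j : Fin (n + 1)) :
    (ringSystem n K M D).C i j = if j = finRotate (n + 1) i then (fun _ : Fin (n + 1) => K) i
      else if i = finRotate (n + 1) j then (fun _ : Fin (n + 1) => K) j else 0 := by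
  rw [ringSystem_C]
  by_cases h1 : j = finRotate (n + 1) i
  · rw [if_pos (Or.inl h1), if_pos h1]
  · by_cases h2 : i = finRotate (n + 1) j
    · rw [if_pos (Or.inr h2), if_neg h1, if_pos h2]
    · rw [if_neg (not_or.2 ⟨h1, h2⟩), if_neg h1, if_neg h2]

/-- **«The cosine of the angle differences along all the lines takes the same absolute value»**: at
a synchronous state of the unloaded homogeneous ring (`N ≥ 3`, `K ≠ 0`) all line sines are equal
(`ring_sin_edge_eq_of_flow_eq_zero`), hence all `|cos(θₖ − θ_{ρk})|` are equal.
[cite: DelabaysColettaJacquod2016, §4.2 proof of Thm 4.1] -/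
theorem ringSystem_abs_cos_eq (hn : 2 ≤ n) (hK : K ≠ 0) {θ : Fin (n + 1) → ℝ}
    (hθ : ∀ k, (ringSystem n K M D).flow θ k = 0) (k : Fin (n + 1)) :
    |Real.cos (θ k - θ (finRotate (n + 1) k))| = |Real.cos (θ 0 - θ (finRotate (n + 1) 0))| := by
  rw [← sq_eq_sq_iff_abs_eq_abs]
  have h1 := ring_sin_edge_eq_of_flow_eq_zero K M D hn hK hθ k
  have h2 := Real.sin_sq_add_cos_sq (θ k - θ (finRotate (n + 1) k))
  have h3 := Real.sin_sq_add_cos_sq (θ 0 - θ (finRotate (n + 1) 0))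
  rw [h1] at h2
  linarith

/-- ★ **A negative direction at every synchronous state outside normal operation** (unloaded
homogeneous ring of `N = n + 1 ≥ 3` machines, `K > 0`): if `flowₖ(θ) = 0` at every node, no line has
zero cosine and SOME line has negative cosine, then `Q(θ; v) < 0` for an explicit `v` — `eₖ` at a node
between two negative lines when all lines are negative (`Q = −2Kc`), otherwise `−e_{ρk} + e_{ρ²k}` at a
node where a positive line `k` is followed by a negative line `ρk` (`Q = Kc − 4Kc ± Kc < 0`, the
source's principal-minor test), `c > 0` the common `|cos|`.
[cite: DelabaysColettaJacquod2016, §4.2 Thm 4.1 and its proof (all-negative and mixed cases)] -/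
theorem ringSystem_exists_negativeDirection_of_long_line (hn : 2 ≤ n) (hK : 0 < K)
    {θ : Fin (n + 1) → ℝ} (hθ : ∀ k, (ringSystem n K M D).flow θ k = 0)
    (h0 : ∀ k, Real.cos (θ k - θ (finRotate (n + 1) k)) ≠ 0)
    (hneg : ∃ k, Real.cos (θ k - θ (finRotate (n + 1) k)) < 0) :
    ∃ v : Fin (n + 1) → ℝ,
      1 / 2 * ∑ i, ∑ j, (ringSystem n K M D).C i j * Real.cos (θ i - θ j) * (v i - v j) ^ 2 < 0 := by
  have hC := ringSystem_C_if K M D (n := n)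
  -- common absolute value `c > 0` of the line cosines
  set c := |Real.cos (θ 0 - θ (finRotate (n + 1) 0))| with hc
  have habs : ∀ k, |Real.cos (θ k - θ (finRotate (n + 1) k))| = c :=
    fun k => ringSystem_abs_cos_eq K M D hn hK.ne' hθ k
  have hcpos : 0 < c := by rw [hc]; exact abs_pos.2 (h0 0)
  have hval : ∀ k, Real.cos (θ k - θ (finRotate (n + 1) k)) = c ∨
      Real.cos (θ k - θ (finRotate (n + 1) k)) = -c := fun k => (abs_eq hcpos.le).1 (habs k)
  by_cases hpos : ∃ k, 0 < Real.cos (θ k - θ (finRotate (n + 1) k))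
  · -- mixed case: a positive line `k` followed by a negative line `ρk`
    obtain ⟨k, hk1, hk2⟩ := exists_short_long_adjacent h0 hpos hneg
    refine ⟨fun i => (if i = finRotate (n + 1) (finRotate (n + 1) k) then (1 : ℝ) else 0)
      - (if i = finRotate (n + 1) k then (1 : ℝ) else 0), ?_⟩
    rw [loadedRing_hessForm_pair (ringSystem n K M D) (fun _ => K) hn hC θ k]
    have e1 : Real.cos (θ k - θ (finRotate (n + 1) k)) = c := by
      rcases hval k with h | h
      · exact h
      · linarith
    have e2 : Real.cos (θ (finRotate (n + 1) k) - θ (finRotate (n + 1) (finRotate (n + 1) k))) = -c := by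
      rcases hval (finRotate (n + 1) k) with h | h
      · linarith
      · exact h
    have e3 : Real.cos (θ (finRotate (n + 1) (finRotate (n + 1) k))
        - θ (finRotate (n + 1) (finRotate (n + 1) (finRotate (n + 1) k)))) ≤ c := by
      rcases hval (finRotate (n + 1) (finRotate (n + 1) k)) with h | h
      · exact h.le
      · linarith
    rw [e1, e2]
    nlinarith
  · -- all lines negative: a single node between its two negative lines
    push Not at hpos
    have hlt : ∀ k, Real.cos (θ k - θ (finRotate (n + 1) k)) < 0 :=
      fun k => lt_of_le_of_ne (hpos k) (h0 k)
    refine ⟨fun i => if i = (0 : Fin (n + 1)) then (1 : ℝ) else 0, ?_⟩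
    rw [loadedRing_hessForm_single (ringSystem n K M D) (fun _ => K) hn hC θ 0]
    have h1 := hlt 0
    have h2 := hlt ((finRotate (n + 1)).symm 0)
    rw [Equiv.apply_symm_apply] at h2
    have h3 := mul_neg_of_pos_of_neg hK h1
    have h4 := mul_neg_of_pos_of_neg hK h2
    linarith

/-- **Hence such a synchronous state is NOT a local minimum of the energy** (no normal-operation
⇒ no energy minimum on the unloaded ring). [cite: DelabaysColettaJacquod2016, §4.2 Thm 4.1; ManikTimmeWitthaut2017, §3 Lemma 1] -/
theorem ringSystem_not_isLocalMin_of_long_line (hn : 2 ≤ n) (hK : 0 < K)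
    {θ : Fin (n + 1) → ℝ} (hθ : ∀ k, (ringSystem n K M D).flow θ k = 0)
    (h0 : ∀ k, Real.cos (θ k - θ (finRotate (n + 1) k)) ≠ 0)
    (hneg : ∃ k, Real.cos (θ k - θ (finRotate (n + 1) k)) < 0) :
    ¬ IsLocalMin (ringSystem n K M D).potential θ := by
  obtain ⟨v, hv⟩ := ringSystem_exists_negativeDirection_of_long_line K M D hn hK hθ h0 hneg
  have he : (ringSystem n K M D).IsEquilibrium θ := fun i => by rw [hθ i]; rfl
  refine (ringSystem n K M D).not_isLocalMin_potential_of_hessForm_neg (ringSystem_C_symm K M D)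
    he v ?_
  simpa only [Finset.univ_eq_empty, Finset.sum_empty, Finset.sum_const_zero, add_zero] using hv

/-- ★★ **THEOREM 4.1 FOR THE MOTIONS, modulo degeneracy**: on the unloaded homogeneous ring of
`N = n + 1 ≥ 3` machines (`K > 0`, `Mᵢ, Dᵢ > 0`), a synchronous state (`flow(θe) = 0`) with NO line
of zero cosine, SOME line of negative cosine, and Hesse matrix nondegenerate transversally to the
rotation is an UNSTABLE synchronous solution of the damped swing model: there is `ε > 0` such that
arbitrarily close to `θe` on its momentum leaf some motion started at rest leaves the `ε`-ball
around the rest point `(θe, 0)` (here `ω_s = 0`).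
[cite: DelabaysColettaJacquod2016, §4.2 Thm 4.1 («any stable solution … has all angle differences in [−π/2, π/2]»); ManikTimmeWitthaut2017, §3 Lemma 1] -/
theorem ringSystem_unstable_syncSolution_of_long_line (hn : 2 ≤ n) (hK : 0 < K)
    (hM : ∀ i, 0 < M i) (hD : ∀ i, 0 < D i)
    {θe : Fin (n + 1) → ℝ} (hθ : ∀ k, (ringSystem n K M D).flow θe k = 0)
    (h0 : ∀ k, Real.cos (θe k - θe (finRotate (n + 1) k)) ≠ 0)
    (hneg : ∃ k, Real.cos (θe k - θe (finRotate (n + 1) k)) < 0)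
    (hker : ∀ v : Fin (n + 1) → ℝ, (ringSystem n K M D).hessMatrix θe *ᵥ v = 0 →
      ∃ a : ℝ, v = fun _ => a) :
    ∃ ε > 0, ∀ δ > 0, ∃ θ₁ : Fin (n + 1) → ℝ, dist θ₁ θe < δ ∧
      ∑ k, D k * θ₁ k = ∑ k, D k * θe k ∧
      ∀ X : ℝ → (Fin (n + 1) → ℝ) × (Fin (n + 1) → ℝ), X 0 = (θ₁, fun _ => (0 : ℝ)) →
        (∀ T : ℝ, ∀ t ∈ Icc 0 T,
          HasDerivWithinAt X ((ringSystem n K M D).field (X t)) (Icc 0 T) t) →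
        ∃ t, 0 ≤ t ∧ ε < dist (X t) (θe, fun _ => (0 : ℝ)) := by
  obtain ⟨v, hv⟩ := ringSystem_exists_negativeDirection_of_long_line K M D hn hK hθ h0 hneg
  have he : ∀ k, (ringSystem n K M D).P k - (ringSystem n K M D).D k
      * ((∑ j, (ringSystem n K M D).P j) / ∑ j, (ringSystem n K M D).D j)
      = (ringSystem n K M D).flow θe k := by
    intro k
    rw [hθ k]
    simp [ringSystem]
  have h := (ringSystem n K M D).unstable_syncSolution_of_negativeDirection_of_nondegenerate
    (ringSystem_C_symm K M D) hM hD he hker v hv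
  have hP : (∑ j, (ringSystem n K M D).P j) / (∑ j, (ringSystem n K M D).D j) = 0 := by
    simp [ringSystem]
  simp only [hP, zero_mul, add_zero] at h
  obtain ⟨ε, hε, hall⟩ := h
  refine ⟨ε, hε, fun δ hδ => ?_⟩
  obtain ⟨θ₁, hd, hl, hesc⟩ := hall δ hδ
  refine ⟨θ₁, hd, ?_, fun X hX0 hX => ?_⟩
  · simpa [ringSystem] using hl
  · obtain ⟨t, ht, hdist⟩ := hesc X hX0 hX
    exact ⟨t, ht, by simpa using hdist⟩

/-- **For an ODD number of machines the nondegeneracy is automatic**: at a synchronous state of the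
unloaded homogeneous ring with no zero-cosine line, every cosine is `±c` (`c > 0` their common
absolute value), so `Σₖ (K cosₖ)⁻¹ = (#positive − #negative)/(Kc)`, and `#positive − #negative` has
the parity of `N` — nonzero for `N` odd. [cite: DelabaysColettaJacquod2016, §4.2 proof of Thm 4.1 («the cosine … takes the same absolute value with either positive or negative sign»)] -/
theorem ringSystem_sum_inv_cos_ne_zero_of_odd (hn : 2 ≤ n) (hodd : Odd (n + 1)) (hK : 0 < K)
    {θ : Fin (n + 1) → ℝ} (hθ : ∀ k, (ringSystem n K M D).flow θ k = 0)
    (h0 : ∀ k, Real.cos (θ k - θ (finRotate (n + 1) k)) ≠ 0) :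
    ∑ k, (K * Real.cos (θ k - θ (finRotate (n + 1) k)))⁻¹ ≠ 0 := by
  set c := |Real.cos (θ 0 - θ (finRotate (n + 1) 0))| with hc
  have habs : ∀ k, |Real.cos (θ k - θ (finRotate (n + 1) k))| = c :=
    fun k => ringSystem_abs_cos_eq K M D hn hK.ne' hθ k
  have hcpos : 0 < c := by rw [hc]; exact abs_pos.2 (h0 0)
  -- each term is `± 1/(Kc)`
  set A : Finset (Fin (n + 1)) :=
    Finset.univ.filter (fun k => 0 < Real.cos (θ k - θ (finRotate (n + 1) k))) with hA
  have hterm : ∀ k, (K * Real.cos (θ k - θ (finRotate (n + 1) k)))⁻¹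
      = if k ∈ A then (K * c)⁻¹ else -(K * c)⁻¹ := by
    intro k
    by_cases hk : 0 < Real.cos (θ k - θ (finRotate (n + 1) k))
    · have hkA : k ∈ A := by rw [hA, Finset.mem_filter]; exact ⟨Finset.mem_univ _, hk⟩
      rw [if_pos hkA, ← habs k, abs_of_pos hk]
    · have hkA : k ∉ A := by rw [hA, Finset.mem_filter]; exact fun h => hk h.2
      have hlt : Real.cos (θ k - θ (finRotate (n + 1) k)) < 0 := lt_of_le_of_ne (not_lt.1 hk) (h0 k)
      rw [if_neg hkA, ← habs k, abs_of_neg hlt, mul_neg, inv_neg, neg_neg]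
  rw [Finset.sum_congr rfl fun k _ => hterm k, Finset.sum_ite, Finset.sum_const, Finset.sum_const,
    nsmul_eq_mul, nsmul_eq_mul]
  -- `#A + #Aᶜ = n + 1` is odd, so `#A ≠ #Aᶜ`
  have hcard : (Finset.univ.filter (fun k => k ∈ A)).card
      + (Finset.univ.filter (fun k => ¬ k ∈ A)).card = n + 1 := by
    have h := Finset.card_filter_add_card_filter_not
      (s := (Finset.univ : Finset (Fin (n + 1)))) (fun k => k ∈ A)
    rw [Finset.card_univ, Fintype.card_fin] at h
    exact h
  have hKc : (K * c)⁻¹ ≠ 0 := inv_ne_zero (mul_ne_zero hK.ne' hcpos.ne')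
  intro h
  have h2 : ((Finset.univ.filter (fun k => k ∈ A)).card : ℝ)
      = ((Finset.univ.filter (fun k => ¬ k ∈ A)).card : ℝ) := by
    have h3 : (((Finset.univ.filter (fun k => k ∈ A)).card : ℝ)
        - ((Finset.univ.filter (fun k => ¬ k ∈ A)).card : ℝ)) * (K * c)⁻¹ = 0 := by
      linarith
    rcases mul_eq_zero.1 h3 with h4 | h4
    · linarith
    · exact absurd h4 hKc
  have h5 : (Finset.univ.filter (fun k => k ∈ A)).card
      = (Finset.univ.filter (fun k => ¬ k ∈ A)).card := by exact_mod_cast h2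
  obtain ⟨m, hm⟩ := hodd
  omega

/-- ★★★ **DELABAYS–COLETTA–JACQUOD THEOREM 4.1 FOR THE MOTIONS, ODD RINGS, HYPOTHESIS-FREE: on the
unloaded homogeneous ring `R_N` with an ODD number `N = n + 1 ≥ 3` of machines (`K > 0`,
`Mᵢ, Dᵢ > 0`), EVERY synchronous state with some line of negative cosine and none of zero cosine is
an UNSTABLE synchronous solution of the damped swing model.** Together with
`ring_normalOperation_census` (every synchronous state with all cosines positive is a STABLE
synchronous state, and these are exactly the `2⌈N/4⌉ − 1` twisted states with `4|q| < N`) this is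
the printed dichotomy «any stable solution … has all angle differences in [−π/2, π/2]; furthermore all
angle differences are equal to 2πq/n» for the motions of MODEL `M`, lines at `cos = 0` excluded.
THREE COLUMNS: CERTIFIED for MODEL `M` = damped lossless swing model on the homogeneous unloaded
ring with `N` odd (MV-1); «unstable» = the synchronous solution of MODEL `M`, never a grid.
[cite: DelabaysColettaJacquod2016, §4.2 Thm 4.1; ManikTimmeWitthaut2017, §3 Lemma 1 and §5.4] -/
theorem ringSystem_unstable_syncSolution_of_long_line_of_odd (hn : 2 ≤ n) (hodd : Odd (n + 1))
    (hK : 0 < K) (hM : ∀ i, 0 < M i) (hD : ∀ i, 0 < D i)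
    {θe : Fin (n + 1) → ℝ} (hθ : ∀ k, (ringSystem n K M D).flow θe k = 0)
    (h0 : ∀ k, Real.cos (θe k - θe (finRotate (n + 1) k)) ≠ 0)
    (hneg : ∃ k, Real.cos (θe k - θe (finRotate (n + 1) k)) < 0) :
    ∃ ε > 0, ∀ δ > 0, ∃ θ₁ : Fin (n + 1) → ℝ, dist θ₁ θe < δ ∧
      ∑ k, D k * θ₁ k = ∑ k, D k * θe k ∧
      ∀ X : ℝ → (Fin (n + 1) → ℝ) × (Fin (n + 1) → ℝ), X 0 = (θ₁, fun _ => (0 : ℝ)) →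
        (∀ T : ℝ, ∀ t ∈ Icc 0 T,
          HasDerivWithinAt X ((ringSystem n K M D).field (X t)) (Icc 0 T) t) →
        ∃ t, 0 ≤ t ∧ ε < dist (X t) (θe, fun _ => (0 : ℝ)) := by
  refine ringSystem_unstable_syncSolution_of_long_line K M D hn hK hM hD hθ h0 hneg ?_
  refine loadedRing_hessMatrix_ker_const (ringSystem n K M D) (fun _ => K) hn
    (ringSystem_C_if K M D) (fun k => mul_ne_zero hK.ne' (h0 k)) ?_
  exact ringSystem_sum_inv_cos_ne_zero_of_odd K M D hn hodd hK hθ h0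

end Ring

end ClassicalModel

end Literature.MathematicalPhysics.PowerSystems

end
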